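import Summits.CriticalPhenomena.PercolationContinuityZ3.Theorems.PercNearOneGluingNoHeavyPcintChainMem
import Summits.CriticalPhenomena.PercolationContinuityZ3.Theorems.PercNearOneGluingNoHeavyPcintThirdBondReduction
import HarnessLib

/-!
# PCINT lane, reduction B3t (`chordthird_cw`) on the memory-`τ` DANGEROUS-SET automaton — the automaton and the unit comparison

Cell `prim-pcint` (PAPER-2 track (iii): certified intervals for `p_c(ℤ^d)`), seat `prim-pcint-2` (gen 4); support file
(`--supports stmt-CriticalPhenomena-4575`).  Does NOT build on p205010.  Memo: `run/shared/lean/prim/pcint/REDUCTIONS.md` §B3t.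

B3t = B3c (`…ChainMem`) with two refinements: (i) a det-paying site whose remembered incidences number at least two, all of
age `≥ 3` (so the new incidence is at least the third of the site and at gap `≥ 4` from the previous one) is a T-SITE (`ctSet`)
and pays the sharper unit `t` instead of `s`; (ii) the chord factor of a step with `c ≥ 1` remembered chord partners is
`(1-p)^c / (s² t^{c-1})` (`tchordF`: the refund is sized to the units an on-path site can have been charged, two `s`-units and
`c - 1` `t`-units).  Per-step weight `btwt = tchordF(bchord) · s^{cdet - ctu} · t^{ctu} · (κ̄ | 1)`, automaton
`bthirdMemAut τ kc`.  Semantic bridge PROVED here: a t-site's new incidence carries a full-information `t`-unit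
(`one_le_uFt_of_mem_ctSet`, with `uFt`/`tunitsAt` the time-resolved `t`-units of `…ThirdBondUnits`).
-/

noncomputable section

namespace Summit.CriticalPhenomena.PercolationContinuityZ3.Theorems.Pcint

open Finset Literature.Probability.Percolation Literature.Probability.LatticeModels ChainBond

variable {d : ℕ}

/-! ### The per-step data of the B3t automaton -/

open Classical in
/-- The T-SITES of the step: det-paying sites with at least two remembered incidences, all of age `≥ 3`. [folklore] -/
def ctSet (kc : ℕ) (S : MState d) (a : Fin d × Bool) : Finset (Site d) :=
  (cdetSet kc S a).filter fun w => 2 ≤ (bcinc S w).card ∧ ∀ q ∈ bcinc S w, 3 ≤ q.2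

/-- T-sites are det-paying sites. [folklore] -/
theorem ctSet_subset (kc : ℕ) (S : MState d) (a : Fin d × Bool) : ctSet kc S a ⊆ cdetSet kc S a := by
  classical
  exact filter_subset _ _

/-- The number of `t`-units of the step. [folklore] -/
def ctu (kc : ℕ) (S : MState d) (a : Fin d × Bool) : ℕ := (ctSet kc S a).card

/-- `ctu ≤ cdet`. [folklore] -/
theorem ctu_le_cdet (τ kc : ℕ) (S : MState d) (a : Fin d × Bool) : ctu kc S a ≤ cdet τ kc S a :=
  (card_le_card (ctSet_subset kc S a)).trans (Nat.le_add_right _ _)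

/-- `ctu ≤ 2d`. [folklore] -/
theorem ctu_le (kc : ℕ) (S : MState d) (a : Fin d × Bool) : ctu kc S a ≤ 2 * d := by
  classical
  exact (card_le_card (ctSet_subset kc S a)).trans ((card_filter_le _ _).trans (card_nbrSites_le _))

/-- The B3t chord factor of a step with `c` remembered chord partners: `1` for `c = 0`, else `q₁^c / (s² t^{c-1})`
(`q₁ = 1 - p`; the denominator is the refund). [folklore] -/
def tchordF (q1 s t : ℝ) (c : ℕ) : ℝ := if c = 0 then 1 else q1 ^ c / (s ^ 2 * t ^ (c - 1))

/-- The chord factor is nonnegative. [folklore] -/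
theorem tchordF_nonneg {q1 s t : ℝ} (hq : 0 ≤ q1) (hs : 0 ≤ s) (ht : 0 ≤ t) (c : ℕ) : 0 ≤ tchordF q1 s t c := by
  unfold tchordF
  split_ifs
  · exact zero_le_one
  · exact div_nonneg (pow_nonneg hq _) (mul_nonneg (pow_nonneg hs _) (pow_nonneg ht _))

/-- The B3t step factor `tchordF(bchord) · s^{cdet - ctu} · t^{ctu} · κ̄^{[bcorner]}`. [folklore] -/
def btwt (q1 s t κb : ℝ) (τ kc : ℕ) (S : MState d) (a : Fin d × Bool) : ℝ :=
  tchordF q1 s t (bchord S a) * (s ^ (cdet τ kc S a - ctu kc S a) * t ^ ctu kc S a * (if bcorner S a then κb else 1))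

/-- The step factor is nonnegative. [folklore] -/
theorem btwt_nonneg {q1 s t κb : ℝ} (hq : 0 ≤ q1) (hs : 0 ≤ s) (ht : 0 ≤ t) (hκb : 0 ≤ κb) (τ kc : ℕ) (S : MState d)
    (a : Fin d × Bool) : 0 ≤ btwt q1 s t κb τ kc S a := by
  unfold btwt
  have := tchordF_nonneg hq hs ht (bchord S a)
  split_ifs <;> positivity

/-- **The B3t automaton on dangerous-set states** (memory `τ`, chain parameter `kc`): step `mstep τ`, weight
`p · tchordF(bchord) · s^{cdet-ctu} · t^{ctu} · κ̄^{[bcorner]}`. [folklore] -/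
def bthirdMemAut (τ kc : ℕ) (p q1 s t κb : ℝ) (hp : 0 ≤ p) (hq : 0 ≤ q1) (hs : 0 ≤ s) (ht : 0 ≤ t) (hκb : 0 ≤ κb) :
    WAut (MState d) (Fin d × Bool) where
  step := mstep τ
  wt S a := p * btwt q1 s t κb τ kc S a
  wt_nonneg S a := mul_nonneg hp (btwt_nonneg hq hs ht hκb τ kc S a)

/-! ### The full-information `t`-units, time by time -/

namespace ChainBond

variable {n : ℕ}

/-- The full-information `t`-units of the incidence of `w` at time `T`. [folklore] -/
def uFt (kc : ℕ) (γ : Fin n → Fin d × Bool) (w : Site d) (T : ℕ) : ℕ :=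
  ((tSet kc γ w).filter fun k => incAt γ w k = T).card

/-- `uFt ≤ uF`. [folklore] -/
theorem uFt_le_uF (kc : ℕ) (γ : Fin n → Fin d × Bool) (w : Site d) (T : ℕ) : uFt kc γ w T ≤ uF kc γ w T := by
  classical
  unfold uFt uF
  exact (card_le_card (filter_subset_filter _ (tSet_subset_paySet kc γ w))).trans (Nat.le_add_right _ _)

/-- The `t`-units paid at time `T`, over all off-path sites. [folklore] -/
def tunitsAt (kc : ℕ) (γ : Fin n → Fin d × Bool) (T : ℕ) : ℕ := ∑ w ∈ offSites γ, uFt kc γ w T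

/-- `tunitsAt ≤ dunitsAt`. [folklore] -/
theorem tunitsAt_le_dunitsAt (kc : ℕ) (γ : Fin n → Fin d × Bool) (T : ℕ) : tunitsAt kc γ T ≤ dunitsAt kc γ T :=
  sum_le_sum fun w _ => uFt_le_uF kc γ w T

/-- **`tTotal = Σ_T tunitsAt T`.** [folklore] -/
theorem tTotal_eq_sum (kc : ℕ) (γ : Fin n → Fin d × Bool) : tTotal kc γ = ∑ T ∈ range (n + 1), tunitsAt kc γ T := by
  classical
  unfold tTotal tunitsAt
  rw [sum_comm]
  refine sum_congr rfl fun w _ => ?_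
  unfold tUnits uFt
  exact card_eq_sum_card_fiberwise (f := incAt γ w) (t := range (n + 1)) fun k hk =>
    mem_range.2 (Nat.lt_succ_of_le (mem_incTimes.1 (incAt_mem (mem_tSet.1 (mem_coe.1 hk)).1.2.1)).1)

/-- `Σ_T uF(w,T) = detUnits w` for every site. [folklore] -/
theorem sum_uF_eq (kc : ℕ) (γ : Fin n → Fin d × Bool) (w : Site d) :
    ∑ T ∈ range (n + 1), uF kc γ w T = detUnits kc γ w := by
  classical
  have hmaps : ∀ k, k < (incTimes γ w).card → incAt γ w k ∈ range (n + 1) := fun k hk =>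
    mem_range.2 (Nat.lt_succ_of_le (mem_incTimes.1 (incAt_mem hk)).1)
  unfold detUnits uF
  rw [sum_add_distrib, card_eq_sum_card_fiberwise (f := incAt γ w) (t := range (n + 1))
      (fun k hk => hmaps k (mem_paySet.1 (mem_coe.1 hk)).2.1),
    card_eq_sum_card_fiberwise (f := incAt γ w) (t := range (n + 1))
      (fun k hk => hmaps k (mem_bonusSet.1 (mem_coe.1 hk)).1.2.1)]

/-- `Σ_T uFt(w,T) = tUnits w` for every site. [folklore] -/
theorem sum_uFt_eq (kc : ℕ) (γ : Fin n → Fin d × Bool) (w : Site d) :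
    ∑ T ∈ range (n + 1), uFt kc γ w T = tUnits kc γ w := by
  classical
  unfold tUnits uFt
  exact (card_eq_sum_card_fiberwise (f := incAt γ w) (t := range (n + 1)) fun k hk =>
    mem_range.2 (Nat.lt_succ_of_le (mem_incTimes.1 (incAt_mem (mem_tSet.1 (mem_coe.1 hk)).1.2.1)).1)).symm

/-- **`sTotal = Σ_T (dunitsAt T - tunitsAt T)`.** [folklore] -/
theorem sTotal_eq_sum (kc : ℕ) (γ : Fin n → Fin d × Bool) :
    sTotal kc γ = ∑ T ∈ range (n + 1), (dunitsAt kc γ T - tunitsAt kc γ T) := by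
  classical
  calc sTotal kc γ = ∑ w ∈ offSites γ, (∑ T ∈ range (n + 1), uF kc γ w T - ∑ T ∈ range (n + 1), uFt kc γ w T) := by
        unfold sTotal; exact sum_congr rfl fun w _ => by rw [sUnits, sum_uF_eq, sum_uFt_eq]
    _ = ∑ w ∈ offSites γ, ∑ T ∈ range (n + 1), (uF kc γ w T - uFt kc γ w T) :=
        sum_congr rfl fun w _ => (sum_tsub_distrib _ fun T _ => uFt_le_uF kc γ w T).symm
    _ = ∑ T ∈ range (n + 1), ∑ w ∈ offSites γ, (uF kc γ w T - uFt kc γ w T) := sum_comm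
    _ = ∑ T ∈ range (n + 1), (dunitsAt kc γ T - tunitsAt kc γ T) :=
        sum_congr rfl fun T _ => by rw [dunitsAt, tunitsAt, sum_tsub_distrib _ fun w _ => uFt_le_uF kc γ w T]

end ChainBond

/-! ### The unit comparison along a self-avoiding word: t-sites carry `t`-units -/

section Along

variable (a₀ : Fin d × Bool) {τ kc n : ℕ} {γ : Fin n → Fin d × Bool}

/-- Distinct remembered sites have distinct ages. [folklore] -/
theorem age_injOn {t : ℕ} (ht : t ≤ n) {q q' : Site d × ℕ} (hq : q ∈ danger τ (pre a₀ γ t))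
    (hq' : q' ∈ danger τ (pre a₀ γ t)) (h : q.2 = q'.2) : q = q' := by
  obtain ⟨-, -, h1⟩ := isRem_of_mem_danger_pre a₀ ht hq
  obtain ⟨-, -, h2⟩ := isRem_of_mem_danger_pre a₀ ht hq'
  refine Prod.ext ?_ h
  rw [h1, h2, h]

open Classical in
/-- **T-sites carry `t`-units**: at a t-site of the step reading letter `t`, the incidence `t + 1` of the absolute site is at
least its third incidence, at gap `≥ 4` from the previous one, linked and not the corner first pair (`kc + 4 ≤ τ`, `2 ≤ kc`).
[folklore] -/
theorem one_le_uFt_of_mem_ctSet (hτ : kc + 4 ≤ τ) (hkc : 2 ≤ kc) {t : ℕ} (ht : t < n) {w' : Site d}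
    (hw' : w' ∈ ctSet kc (danger τ (pre a₀ γ t)) (γ ⟨t, ht⟩)) : 1 ≤ uFt kc γ (w' + wordPos γ t) (t + 1) := by
  set S := danger τ (pre a₀ γ t) with hS
  set w := w' + wordPos γ t with hw
  rw [ctSet, mem_filter] at hw'
  obtain ⟨hD, hcard2, hage3⟩ := hw'
  rw [cdetSet, mem_filter, mem_nbrSites] at hD
  obtain ⟨hadj', -, -, ⟨qd, hqd, hqd2⟩, ⟨ql, hql, hqlk⟩⟩ := hD
  have hadj : (zdGraph d).Adj (wordPos γ (t + 1)) w := by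
    rw [hw, ← adj_sub_wordPos_iff γ t, ← stepVec_eq_sub ht, add_sub_cancel_right]; exact hadj'
  have hT : t + 1 ∈ incTimes γ w := mem_incTimes.2 ⟨by omega, hadj⟩
  have ht_not : t ∉ incTimes γ w := fun h =>
    zdGraph_no_triangle (zdGraph_adj_wordPos_succ γ ht) hadj (mem_incTimes.1 h).2
  obtain ⟨k, hk, hkT⟩ := exists_incAt_eq hT
  have hidx : ∀ {i}, i ∈ incTimes γ w → i < t + 1 → ∃ j, j < k ∧ incAt γ w j = i := by
    intro i hi hit
    obtain ⟨j, hj, hji⟩ := exists_incAt_eq hi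
    refine ⟨j, ?_, hji⟩
    by_contra hjk
    rcases Nat.lt_or_ge k j with h | h
    · have := incAt_strictMono h hj; omega
    · have : j = k := by omega
      subst this; omega
  have hprev_ge : ∀ {i}, i ∈ incTimes γ w → i < t + 1 → i ≤ incAt γ w (k - 1) := by
    intro i hi hit
    obtain ⟨j, hj, hji⟩ := hidx hi hit
    rw [← hji]
    rcases Nat.lt_or_ge j (k - 1) with h | h
    · exact (incAt_strictMono h (by omega)).le
    · have : j = k - 1 := by omega
      rw [this]
  obtain ⟨hqd_inc, hqd1, hqd_le, -⟩ := inc_of_mem_bcinc a₀ ht hqd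
  obtain ⟨hql_inc, hql1, hql_le, -⟩ := inc_of_mem_bcinc a₀ ht hql
  have hk1 : 1 ≤ k := by
    obtain ⟨j, hj, -⟩ := hidx hqd_inc (by omega)
    omega
  have hprev_lt : incAt γ w (k - 1) < t + 1 := by rw [← hkT]; exact incAt_strictMono (by omega) hk
  have hprev_mem : incAt γ w (k - 1) ∈ incTimes γ w := incAt_mem (by omega)
  have hprev_le_t1 : incAt γ w (k - 1) ≤ t - 1 := by
    have h1 : incAt γ w (k - 1) ≠ t := fun h => ht_not (h ▸ hprev_mem)
    omega
  have hlinked : linkedAt kc γ w k := by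
    refine ⟨hk1, ?_⟩
    have := hprev_ge hql_inc (by omega)
    omega
  have hnotfirst : ¬ (k = 1 ∧ firstCorner γ w) := by
    rintro ⟨rfl, -, h01⟩
    obtain ⟨j, hj, hji⟩ := hidx hqd_inc (by omega)
    have hj0 : j = 0 := by omega
    subst hj0
    omega
  have hpays : paysAt kc γ w k := ⟨hk1, hk, hlinked, hnotfirst⟩
  -- at least the third incidence: two distinct remembered incidences give two indices below `k`
  have hk2 : 2 ≤ k := by
    obtain ⟨q, hq, q', hq', hne⟩ := one_lt_card.1 hcard2
    obtain ⟨hq_inc, hq1, hq_le, -⟩ := inc_of_mem_bcinc a₀ ht hq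
    obtain ⟨hq'_inc, hq'1, hq'_le, -⟩ := inc_of_mem_bcinc a₀ ht hq'
    obtain ⟨j, hj, hji⟩ := hidx hq_inc (by omega)
    obtain ⟨j', hj', hj'i⟩ := hidx hq'_inc (by omega)
    have hjj : j ≠ j' := by
      intro hjj
      subst hjj
      have hage : q.2 = q'.2 := by omega
      exact hne (age_injOn a₀ ht.le (mem_bcinc.1 hq).1 (mem_bcinc.1 hq').1 hage)
    omega
  -- gap `≥ 4`: otherwise the previous incidence would be remembered with age `≤ 2`
  have hgap : incAt γ w (k - 1) + 4 ≤ incAt γ w k := by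
    rw [hkT]
    by_contra hlt
    have hage : t ≤ incAt γ w (k - 1) + (τ - 3) := by omega
    have hrem : IsRem τ γ (incAt γ w (k - 1)) t :=
      isRem_of_adj (by exact ht) (by omega) hage (by omega) hadj (mem_incTimes.1 hprev_mem).2
    have hmem := mem_bcinc_of_isRem a₀ ht (w' := w') hrem (by rw [← hw]; exact (mem_incTimes.1 hprev_mem).2)
    have := hage3 _ hmem
    simp only at this
    omega
  have hkt : k ∈ tSet kc γ w := mem_tSet.2 ⟨hpays, hk2, hgap⟩
  unfold ChainBond.uFt
  exact card_pos.2 ⟨k, mem_filter.2 ⟨hkt, hkT⟩⟩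

end Along

end Summit.CriticalPhenomena.PercolationContinuityZ3.Theorems.Pcint
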